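import Summits.RiemannHypothesis.RiemannHypothesis.Theorems.JensenPolynomialsFarGumbelCurvature

/-!
# Route `JensenPolynomials`, FAR crux `XiWindowZeroFreeRelFar` (B1-rel far) — S3 WANTED item (L1), part 1: algebra and
sizes at the centre of the saddle disc (RH-FREE; cell rh-jensen, HUMAN RULING D-0040)

Item `stmt-RiemannHypothesis-19465`, stub S3 `stub_laplaceFar`, WANTED list v3 item (L1) `wanted_saddle` (proved in
`JensenPolynomialsFarGumbelSaddle`). This file holds the EXACT closed forms of `Ψ′(u₀)`, `Ψ″(u₀)` at the disc centre
`u₀ = υ + ξ₀/4` and the crude sizes of the small quantities. With `ε = 1/υ`, `w = farW z̃`, `L = Log w`,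
`θ = εL(1/4 − w/2)`, `s = ε(L+θ)/4` (so `u₀ = υ(1+s)`), `P = 2s + s²` (so `u₀² + a = υ²(1+wP)/w`), `2M − 1 = υ(4Λ − 9 − ε)`,
`X = πe^{4u₀} = Λwe^{θ}`, `R = (1+s)/(1+wP)`, `Q = (1 − 2w − wP)/(1+wP)²`:

* `saddle_psi1_alg`: `9 − 4X + 1/u₀ + (2M−1)u₀/(u₀²+a) = −4Λw(e^θ − R) + (9 + ε/(1+s) − (9+ε)wR)`;
* `saddle_psi2_alg`: `−16X − 1/u₀² + (2M−1)(a−u₀²)/(u₀²+a)² = −16Λw(e^θ − (ε/4)Q) − ε²/(1+s)² − ε(9+ε)wQ`;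
* `saddle_A_alg`: the second-order cancellation `1 + θ − R = (θwP − (ε/4)θ(1−2w) + ws²)/(1+wP)`;
* `saddle_estimates`: on `‖z̃‖ ≤ 9/25`, `0 < ε ≤ 20/189`: `25/34 ≤ ‖w‖ ≤ 25/16`, `‖e^θ − R‖ ≤ 0.33ε²`,
  `‖e^θ − (ε/4)Q‖ ≥ 9/10`, `‖9 + ε/(1+s) − (9+ε)wR‖ ≤ 25`, `‖−ε²/(1+s)² − ε(9+ε)wQ‖ ≤ 4`
  (constants: `‖L‖ ≤ 37/80`, `‖1 − 2w‖ ≤ 17/8`, `‖θ‖ ≤ (629/2560)ε`, `‖s‖ ≤ (979/8000)ε`, `‖P‖ ≤ ε/4`, `‖wP‖ ≤ 0.042`;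
  numerically `‖e^θ − R‖ ≤ 0.161ε²`, `‖e^θ − (ε/4)Q‖ ≥ 1.0004`).
WHAT THIS IS NOT: elementary bookkeeping about an explicit phase function; nothing here bears on the zeros of `ζ` or RH.
-/

noncomputable section
-- D-0017: `Summit.RiemannHypothesis.RiemannHypothesis.…` duplicates the namespace BY DESIGN (single-problem summit).
set_option linter.dupNamespace false

namespace Summit.RiemannHypothesis.RiemannHypothesis.Theorems.JensenPolynomials.FarGumbel

open Complex Metric
open scoped Real

/-! ## 1. Algebra at the disc centre -/

/-- Algebra at the disc centre, I: with `w ≠ 0`, `a = υ²(w⁻¹ − 1)`, `u₀ = υ(1+s)`, `P = 2s + s²`: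
`u₀² + a = υ²(1 + wP)/w`. -/
theorem saddle_sq_add_eq (υc w a s P u₀ : ℂ) (hw : w ≠ 0) (ha : a = υc ^ 2 * (w⁻¹ - 1))
    (hu : u₀ = υc * (1 + s)) (hP : P = 2 * s + s ^ 2) : u₀ ^ 2 + a = υc ^ 2 * (1 + w * P) / w := by
  subst ha hu hP
  field_simp
  ring

/-- Algebra at the disc centre, II (the first derivative): with `ε υ = 1`, `T = υ(4Λ − 9 − ε)` (`= 2M − 1`),
`X = Λ w E` (`= πe^{4u₀}`): `9 − 4X + 1/u₀ + T u₀/(u₀² + a) = −4Λw(E − R) + (9 + ε/(1+s) − (9+ε)wR)`, `R = (1+s)/(1+wP)`. -/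
theorem saddle_psi1_alg (υc ε w a s P u₀ Λ E T : ℂ) (hυ : υc ≠ 0) (hε : ε = υc⁻¹) (hw : w ≠ 0)
    (ha : a = υc ^ 2 * (w⁻¹ - 1)) (hu : u₀ = υc * (1 + s)) (hP : P = 2 * s + s ^ 2)
    (hT : T = υc * (4 * Λ - 9 - ε)) (h1s : 1 + s ≠ 0) (h1wP : 1 + w * P ≠ 0) :
    9 - 4 * (Λ * w * E) + 1 / u₀ + T * u₀ / (u₀ ^ 2 + a) =
      -4 * Λ * w * (E - (1 + s) / (1 + w * P)) +
        (9 + ε / (1 + s) - (9 + ε) * w * ((1 + s) / (1 + w * P))) := by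
  rw [saddle_sq_add_eq υc w a s P u₀ hw ha hu hP]
  subst hε hT hu
  field_simp
  ring

/-- Algebra at the disc centre, III (the second derivative):
`−16X − 1/u₀² + T(a − u₀²)/(u₀² + a)² = −16Λw(E − (ε/4)Q) − ε²/(1+s)² − ε(9+ε)wQ`, `Q = (1 − 2w − wP)/(1+wP)²`. -/
theorem saddle_psi2_alg (υc ε w a s P u₀ Λ E T : ℂ) (hυ : υc ≠ 0) (hε : ε = υc⁻¹) (hw : w ≠ 0)
    (ha : a = υc ^ 2 * (w⁻¹ - 1)) (hu : u₀ = υc * (1 + s)) (hP : P = 2 * s + s ^ 2)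
    (hT : T = υc * (4 * Λ - 9 - ε)) (h1s : 1 + s ≠ 0) (h1wP : 1 + w * P ≠ 0) :
    -16 * (Λ * w * E) - 1 / u₀ ^ 2 + T * (a - u₀ ^ 2) / (u₀ ^ 2 + a) ^ 2 =
      -16 * Λ * w * (E - ε / 4 * ((1 - 2 * w - w * P) / (1 + w * P) ^ 2)) - ε ^ 2 / (1 + s) ^ 2 -
        ε * (9 + ε) * w * ((1 - 2 * w - w * P) / (1 + w * P) ^ 2) := by
  rw [saddle_sq_add_eq υc w a s P u₀ hw ha hu hP]
  subst hε hT hu ha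
  field_simp
  subst hP
  ring

/-- Algebra at the disc centre, IV (the second-order cancellation in `A = e^θ − R`): with `θ = L·ε(1/4 − w/2)`,
`s = ε(L + θ)/4`, `P = 2s + s²`: `1 + θ − (1+s)/(1+wP) = (θ·wP − (ε/4)θ(1 − 2w) + w s²)/(1 + wP)`. -/
theorem saddle_A_alg (ε w L θ s P : ℂ) (hθ : θ = L * (ε * (1 / 4 - w / 2))) (hs : s = ε * (L + θ) / 4)
    (hP : P = 2 * s + s ^ 2) (h1wP : 1 + w * P ≠ 0) :
    1 + θ - (1 + s) / (1 + w * P) = (θ * (w * P) - ε / 4 * θ * (1 - 2 * w) + w * s ^ 2) / (1 + w * P) := by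
  rw [eq_div_iff h1wP]
  field_simp
  subst hP
  subst hs
  subst hθ
  ring

/-! ## 2. The small quantities -/

set_option maxHeartbeats 400000 in
/-- **The small quantities at the disc centre.** For `‖z̃‖ ≤ 9/25`, `0 < ε ≤ 20/189`, with `w = farW z̃`, `L = Log w`,
`θ = L·ε(1/4 − w/2)`, `s = ε(L+θ)/4`, `P = 2s + s²`, `R = (1+s)/(1+wP)`, `Q = (1 − 2w − wP)/(1+wP)²`:
`w ≠ 0`, `25/34 ≤ ‖w‖ ≤ 25/16`, `1 + s ≠ 0`, `1 + wP ≠ 0`, and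
`‖e^θ − R‖ ≤ 0.33ε²` (the second-order cancellation `f′(ξ₀) = O(ε²)`), `‖e^θ − (ε/4)Q‖ ≥ 9/10`,
`‖9 + ε/(1+s) − (9+ε)wR‖ ≤ 25`, `‖−ε²/(1+s)² − ε(9+ε)wQ‖ ≤ 4`. -/
theorem saddle_estimates {z w L θ s P : ℂ} {ε : ℝ} (hz : ‖z‖ ≤ 9 / 25) (hε : 0 < ε) (hε' : ε ≤ 20 / 189)
    (hw : w = farW z) (hL : L = Complex.log w) (hθ : θ = L * ((ε : ℂ) * (1 / 4 - w / 2)))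
    (hs : s = (ε : ℂ) * (L + θ) / 4) (hP : P = 2 * s + s ^ 2) :
    w ≠ 0 ∧ 25 / 34 ≤ ‖w‖ ∧ ‖w‖ ≤ 25 / 16 ∧ 1 + s ≠ 0 ∧ 1 + w * P ≠ 0 ∧
    ‖Complex.exp θ - (1 + s) / (1 + w * P)‖ ≤ 33 / 100 * ε ^ 2 ∧
    9 / 10 ≤ ‖Complex.exp θ - (ε : ℂ) / 4 * ((1 - 2 * w - w * P) / (1 + w * P) ^ 2)‖ ∧
    ‖(9 : ℂ) + (ε : ℂ) / (1 + s) - (9 + (ε : ℂ)) * w * ((1 + s) / (1 + w * P))‖ ≤ 25 ∧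
    ‖-(ε : ℂ) ^ 2 / (1 + s) ^ 2 - (ε : ℂ) * (9 + (ε : ℂ)) * w * ((1 - 2 * w - w * P) / (1 + w * P) ^ 2)‖ ≤ 4 := by
  have hε0 : 0 ≤ ε := hε.le
  have hεn : ‖(ε : ℂ)‖ = ε := by rw [Complex.norm_real, Real.norm_eq_abs, abs_of_pos hε]
  have h9ε : ‖(9 : ℂ) + (ε : ℂ)‖ = 9 + ε := by
    have e : (9 : ℂ) + (ε : ℂ) = ((9 + ε : ℝ) : ℂ) := by push_cast; ring
    rw [e, Complex.norm_real, Real.norm_eq_abs, abs_of_pos (by linarith)]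
  -- `w`
  have hw' : w = (1 + z)⁻¹ := by rw [hw]; rfl
  have hz1 : ‖z‖ < 1 := by linarith
  have h1z : 1 + z ≠ 0 := by
    intro h
    have : ‖(1 : ℂ)‖ = ‖-z‖ := by rw [eq_neg_of_add_eq_zero_left h]
    rw [norm_one, norm_neg] at this
    linarith
  have hwre : 25 / 34 ≤ w.re := by
    have := re_inv_one_add_ge hz (by norm_num : (9 / 25 : ℝ) < 1)
    rw [hw']
    norm_num at this ⊢
    exact this
  have hwn : ‖w‖ ≤ 25 / 16 := by
    have := norm_inv_one_add_le hz (by norm_num : (9 / 25 : ℝ) < 1)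
    rw [hw']
    norm_num at this ⊢
    exact this
  have hwlo : 25 / 34 ≤ ‖w‖ := hwre.trans (Complex.re_le_norm w)
  have hw0 : w ≠ 0 := by
    intro h; rw [h] at hwre; simp at hwre; linarith
  have hw1 : w * (1 + z) = 1 := by rw [hw']; exact inv_mul_cancel₀ h1z
  -- `L`, `1 − 2w`, `θ`
  have hLn : ‖L‖ ≤ 37 / 80 := by rw [hL, hw]; exact norm_log_farW_le hz
  have h12w : ‖1 - 2 * w‖ ≤ 17 / 8 := by
    have e : 1 - 2 * w = w * (z - 1) := by linear_combination (-1 : ℂ) * hw1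
    rw [e, norm_mul]
    have : ‖z - 1‖ ≤ 34 / 25 := by
      calc ‖z - 1‖ ≤ ‖z‖ + ‖(1 : ℂ)‖ := norm_sub_le _ _
        _ ≤ 9 / 25 + 1 := by rw [norm_one]; linarith
        _ = 34 / 25 := by norm_num
    calc ‖w‖ * ‖z - 1‖ ≤ 25 / 16 * (34 / 25) := mul_le_mul hwn this (norm_nonneg _) (by norm_num)
      _ = 17 / 8 := by norm_num
  have hθε : ‖θ‖ ≤ 629 / 2560 * ε := by
    have e : θ = L * (ε : ℂ) * ((1 - 2 * w) / 4) := by rw [hθ]; ring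
    rw [e, norm_mul, norm_mul, hεn, norm_div]
    have e4 : ‖(4 : ℂ)‖ = 4 := by simp
    rw [e4]
    calc ‖L‖ * ε * (‖1 - 2 * w‖ / 4) ≤ 37 / 80 * ε * ((17 / 8) / 4) := by gcongr
      _ = 629 / 2560 * ε := by ring
  have hθ1 : ‖θ‖ ≤ 27 / 1000 := by nlinarith
  have hLθ : ‖L + θ‖ ≤ 979 / 2000 := by
    calc ‖L + θ‖ ≤ ‖L‖ + ‖θ‖ := norm_add_le _ _
      _ ≤ 37 / 80 + 27 / 1000 := add_le_add hLn hθ1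
      _ = 979 / 2000 := by norm_num
  -- `s`, `P`, `wP`
  have hsε : ‖s‖ ≤ 979 / 8000 * ε := by
    rw [hs, norm_div, norm_mul, hεn]
    have e4 : ‖(4 : ℂ)‖ = 4 := by simp
    rw [e4]
    calc ε * ‖L + θ‖ / 4 ≤ ε * (979 / 2000) / 4 := by gcongr
      _ = 979 / 8000 * ε := by ring
  have hs1 : ‖s‖ ≤ 13 / 1000 := by nlinarith
  have hPε : ‖P‖ ≤ ε / 4 := by
    rw [hP]
    have e : 2 * s + s ^ 2 = s * (2 + s) := by ring
    rw [e, norm_mul]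
    have h2s : ‖2 + s‖ ≤ 2013 / 1000 := by
      calc ‖2 + s‖ ≤ ‖(2 : ℂ)‖ + ‖s‖ := norm_add_le _ _
        _ ≤ 2 + 13 / 1000 := by
            have e2 : ‖(2 : ℂ)‖ = 2 := by simp
            rw [e2]; linarith
        _ = 2013 / 1000 := by norm_num
    calc ‖s‖ * ‖2 + s‖ ≤ 979 / 8000 * ε * (2013 / 1000) :=
          mul_le_mul hsε h2s (norm_nonneg _) (by positivity)
      _ ≤ ε / 4 := by nlinarith
  have hwPε : ‖w * P‖ ≤ 25 / 64 * ε := by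
    rw [norm_mul]
    calc ‖w‖ * ‖P‖ ≤ 25 / 16 * (ε / 4) := mul_le_mul hwn hPε (norm_nonneg _) (by norm_num)
      _ = 25 / 64 * ε := by ring
  have hwP : ‖w * P‖ ≤ 42 / 1000 := by nlinarith
  have h1wP : 958 / 1000 ≤ ‖1 + w * P‖ := by
    have h := norm_sub_norm_le (1 : ℂ) (-(w * P))
    rw [norm_neg, sub_neg_eq_add, norm_one] at h
    linarith
  have h1wP0 : 1 + w * P ≠ 0 := by
    intro h; rw [h, norm_zero] at h1wP; linarith
  have h1s : 987 / 1000 ≤ ‖1 + s‖ := by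
    have h := norm_sub_norm_le (1 : ℂ) (-s)
    rw [norm_neg, sub_neg_eq_add, norm_one] at h
    linarith
  have h1s0 : 1 + s ≠ 0 := by
    intro h; rw [h, norm_zero] at h1s; linarith
  refine ⟨hw0, hwlo, hwn, h1s0, h1wP0, ?_, ?_, ?_, ?_⟩
  · -- (A) the second-order cancellation
    have hid := saddle_A_alg (ε : ℂ) w L θ s P hθ hs hP h1wP0
    have e : Complex.exp θ - (1 + s) / (1 + w * P) =
        (Complex.exp θ - 1 - θ) + (θ * (w * P) - (ε : ℂ) / 4 * θ * (1 - 2 * w) + w * s ^ 2) / (1 + w * P) := by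
      linear_combination hid
    rw [e]
    have hE2 : ‖Complex.exp θ - 1 - θ‖ ≤ ‖θ‖ ^ 2 := Complex.norm_exp_sub_one_sub_id_le (by linarith)
    have hN : ‖θ * (w * P) - (ε : ℂ) / 4 * θ * (1 - 2 * w) + w * s ^ 2‖ ≤ ε ^ 2 / 4 := by
      have e4 : ‖(ε : ℂ) / 4‖ = ε / 4 := by
        rw [norm_div, hεn]; have : ‖(4 : ℂ)‖ = 4 := by simp
        rw [this]
      have t1 : ‖θ * (w * P)‖ ≤ (629 / 2560 * ε) * (25 / 64 * ε) := by
        rw [norm_mul]; exact mul_le_mul hθε hwPε (norm_nonneg _) (by positivity)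
      have t2 : ‖(ε : ℂ) / 4 * θ * (1 - 2 * w)‖ ≤ ε / 4 * (629 / 2560 * ε) * (17 / 8) := by
        rw [norm_mul, norm_mul, e4]
        exact mul_le_mul (mul_le_mul_of_nonneg_left hθε (by positivity)) h12w (norm_nonneg _) (by positivity)
      have t3 : ‖w * s ^ 2‖ ≤ 25 / 16 * (979 / 8000 * ε) ^ 2 := by
        rw [norm_mul, norm_pow]
        exact mul_le_mul hwn (pow_le_pow_left₀ (norm_nonneg _) hsε 2) (by positivity) (by norm_num)
      calc ‖θ * (w * P) - (ε : ℂ) / 4 * θ * (1 - 2 * w) + w * s ^ 2‖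
          ≤ ‖θ * (w * P) - (ε : ℂ) / 4 * θ * (1 - 2 * w)‖ + ‖w * s ^ 2‖ := norm_add_le _ _
        _ ≤ ‖θ * (w * P)‖ + ‖(ε : ℂ) / 4 * θ * (1 - 2 * w)‖ + ‖w * s ^ 2‖ := by
            gcongr; exact norm_sub_le _ _
        _ ≤ (629 / 2560 * ε) * (25 / 64 * ε) + ε / 4 * (629 / 2560 * ε) * (17 / 8) +
              25 / 16 * (979 / 8000 * ε) ^ 2 := by gcongr
        _ ≤ ε ^ 2 / 4 := by nlinarith [sq_nonneg ε]
    have hNq : ‖(θ * (w * P) - (ε : ℂ) / 4 * θ * (1 - 2 * w) + w * s ^ 2) / (1 + w * P)‖ ≤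
        ε ^ 2 / 4 / (958 / 1000) := by
      rw [norm_div]
      exact div_le_div₀ (by positivity) hN (by norm_num) h1wP
    have hθ2 : ‖θ‖ ^ 2 ≤ (629 / 2560 * ε) ^ 2 := pow_le_pow_left₀ (norm_nonneg _) hθε 2
    calc ‖(Complex.exp θ - 1 - θ) + (θ * (w * P) - (ε : ℂ) / 4 * θ * (1 - 2 * w) + w * s ^ 2) / (1 + w * P)‖
        ≤ ‖Complex.exp θ - 1 - θ‖ + ‖(θ * (w * P) - (ε : ℂ) / 4 * θ * (1 - 2 * w) + w * s ^ 2) / (1 + w * P)‖ :=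
          norm_add_le _ _
      _ ≤ (629 / 2560 * ε) ^ 2 + ε ^ 2 / 4 / (958 / 1000) := add_le_add (hE2.trans hθ2) hNq
      _ ≤ 33 / 100 * ε ^ 2 := by nlinarith [sq_nonneg ε]
  · -- (B) the curvature factor from below
    have hQ : ‖(1 - 2 * w - w * P) / (1 + w * P) ^ 2‖ ≤ 237 / 100 := by
      rw [norm_div, norm_pow]
      have hnum : ‖1 - 2 * w - w * P‖ ≤ 17 / 8 + 42 / 1000 := by
        calc ‖1 - 2 * w - w * P‖ ≤ ‖1 - 2 * w‖ + ‖w * P‖ := norm_sub_le _ _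
          _ ≤ 17 / 8 + 42 / 1000 := add_le_add h12w hwP
      have hden : (958 / 1000 : ℝ) ^ 2 ≤ ‖1 + w * P‖ ^ 2 := pow_le_pow_left₀ (by norm_num) h1wP 2
      calc ‖1 - 2 * w - w * P‖ / ‖1 + w * P‖ ^ 2 ≤ (17 / 8 + 42 / 1000) / (958 / 1000) ^ 2 :=
            div_le_div₀ (by norm_num) hnum (by norm_num) hden
        _ ≤ 237 / 100 := by norm_num
    have hE1 : ‖Complex.exp θ - 1‖ ≤ 27 / 1000 + (27 / 1000) ^ 2 := by
      have h1 := Complex.norm_exp_sub_one_sub_id_le (x := θ) (by linarith)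
      have e : Complex.exp θ - 1 = (Complex.exp θ - 1 - θ) + θ := by ring
      rw [e]
      calc ‖(Complex.exp θ - 1 - θ) + θ‖ ≤ ‖Complex.exp θ - 1 - θ‖ + ‖θ‖ := norm_add_le _ _
        _ ≤ ‖θ‖ ^ 2 + ‖θ‖ := by gcongr
        _ ≤ (27 / 1000) ^ 2 + 27 / 1000 := by gcongr
        _ = 27 / 1000 + (27 / 1000) ^ 2 := by ring
    have hεQ : ‖(ε : ℂ) / 4 * ((1 - 2 * w - w * P) / (1 + w * P) ^ 2)‖ ≤ (20 / 189) / 4 * (237 / 100) := by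
      rw [norm_mul, norm_div, hεn]
      have : ‖(4 : ℂ)‖ = 4 := by simp
      rw [this]
      exact mul_le_mul (by linarith) hQ (norm_nonneg _) (by norm_num)
    have h := norm_sub_norm_le (1 : ℂ)
      (-(Complex.exp θ - 1) + (ε : ℂ) / 4 * ((1 - 2 * w - w * P) / (1 + w * P) ^ 2))
    have e : (1 : ℂ) - (-(Complex.exp θ - 1) + (ε : ℂ) / 4 * ((1 - 2 * w - w * P) / (1 + w * P) ^ 2)) =
        Complex.exp θ - (ε : ℂ) / 4 * ((1 - 2 * w - w * P) / (1 + w * P) ^ 2) := by ring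
    rw [e, norm_one] at h
    have h2 : ‖-(Complex.exp θ - 1) + (ε : ℂ) / 4 * ((1 - 2 * w - w * P) / (1 + w * P) ^ 2)‖ ≤
        (27 / 1000 + (27 / 1000) ^ 2) + (20 / 189) / 4 * (237 / 100) := by
      calc _ ≤ ‖-(Complex.exp θ - 1)‖ + ‖(ε : ℂ) / 4 * ((1 - 2 * w - w * P) / (1 + w * P) ^ 2)‖ :=
            norm_add_le _ _
        _ ≤ _ := by rw [norm_neg]; exact add_le_add hE1 hεQ
    linarith
  · -- (J₁)
    have hR : ‖(1 + s) / (1 + w * P)‖ ≤ 106 / 100 := by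
      rw [norm_div]
      have hnum : ‖1 + s‖ ≤ 1 + 13 / 1000 := by
        calc ‖1 + s‖ ≤ ‖(1 : ℂ)‖ + ‖s‖ := norm_add_le _ _
          _ ≤ 1 + 13 / 1000 := by rw [norm_one]; linarith
      calc ‖1 + s‖ / ‖1 + w * P‖ ≤ (1 + 13 / 1000) / (958 / 1000) := div_le_div₀ (by norm_num) hnum (by norm_num) h1wP
        _ ≤ 106 / 100 := by norm_num
    have t1 : ‖(ε : ℂ) / (1 + s)‖ ≤ (20 / 189) / (987 / 1000) := by
      rw [norm_div, hεn]; exact div_le_div₀ (by norm_num) hε' (by norm_num) h1s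
    have t2 : ‖(9 + (ε : ℂ)) * w * ((1 + s) / (1 + w * P))‖ ≤ (9 + 20 / 189) * (25 / 16) * (106 / 100) := by
      rw [norm_mul, norm_mul, h9ε]
      exact mul_le_mul (mul_le_mul (by linarith) hwn (norm_nonneg _) (by norm_num)) hR (norm_nonneg _)
        (by positivity)
    calc ‖(9 : ℂ) + (ε : ℂ) / (1 + s) - (9 + (ε : ℂ)) * w * ((1 + s) / (1 + w * P))‖
        ≤ ‖(9 : ℂ) + (ε : ℂ) / (1 + s)‖ + ‖(9 + (ε : ℂ)) * w * ((1 + s) / (1 + w * P))‖ := norm_sub_le _ _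
      _ ≤ ‖(9 : ℂ)‖ + ‖(ε : ℂ) / (1 + s)‖ + ‖(9 + (ε : ℂ)) * w * ((1 + s) / (1 + w * P))‖ := by
          gcongr; exact norm_add_le _ _
      _ ≤ 9 + (20 / 189) / (987 / 1000) + (9 + 20 / 189) * (25 / 16) * (106 / 100) := by
          have e9 : ‖(9 : ℂ)‖ = 9 := by simp
          rw [e9]; exact add_le_add (add_le_add le_rfl t1) t2
      _ ≤ 25 := by norm_num
  · -- (J₂)
    have hQ : ‖(1 - 2 * w - w * P) / (1 + w * P) ^ 2‖ ≤ 237 / 100 := by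
      rw [norm_div, norm_pow]
      have hnum : ‖1 - 2 * w - w * P‖ ≤ 17 / 8 + 42 / 1000 := by
        calc ‖1 - 2 * w - w * P‖ ≤ ‖1 - 2 * w‖ + ‖w * P‖ := norm_sub_le _ _
          _ ≤ 17 / 8 + 42 / 1000 := add_le_add h12w hwP
      have hden : (958 / 1000 : ℝ) ^ 2 ≤ ‖1 + w * P‖ ^ 2 := pow_le_pow_left₀ (by norm_num) h1wP 2
      calc ‖1 - 2 * w - w * P‖ / ‖1 + w * P‖ ^ 2 ≤ (17 / 8 + 42 / 1000) / (958 / 1000) ^ 2 :=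
            div_le_div₀ (by norm_num) hnum (by norm_num) hden
        _ ≤ 237 / 100 := by norm_num
    have t1 : ‖-(ε : ℂ) ^ 2 / (1 + s) ^ 2‖ ≤ (20 / 189) ^ 2 / (987 / 1000) ^ 2 := by
      rw [norm_div, norm_neg, norm_pow, norm_pow, hεn]
      exact div_le_div₀ (by norm_num) (pow_le_pow_left₀ hε0 hε' 2) (by norm_num)
        (pow_le_pow_left₀ (by norm_num) h1s 2)
    have t2 : ‖(ε : ℂ) * (9 + (ε : ℂ)) * w * ((1 - 2 * w - w * P) / (1 + w * P) ^ 2)‖ ≤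
        20 / 189 * (9 + 20 / 189) * (25 / 16) * (237 / 100) := by
      rw [norm_mul, norm_mul, norm_mul, hεn, h9ε]
      refine mul_le_mul (mul_le_mul (mul_le_mul hε' (by linarith) (by linarith) (by norm_num)) hwn
        (norm_nonneg _) (by positivity)) hQ (norm_nonneg _) (by positivity)
    calc ‖-(ε : ℂ) ^ 2 / (1 + s) ^ 2 - (ε : ℂ) * (9 + (ε : ℂ)) * w * ((1 - 2 * w - w * P) / (1 + w * P) ^ 2)‖
        ≤ ‖-(ε : ℂ) ^ 2 / (1 + s) ^ 2‖ + ‖(ε : ℂ) * (9 + (ε : ℂ)) * w * ((1 - 2 * w - w * P) / (1 + w * P) ^ 2)‖ :=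
          norm_sub_le _ _
      _ ≤ (20 / 189) ^ 2 / (987 / 1000) ^ 2 + 20 / 189 * (9 + 20 / 189) * (25 / 16) * (237 / 100) :=
          add_le_add t1 t2
      _ ≤ 4 := by norm_num


end Summit.RiemannHypothesis.RiemannHypothesis.Theorems.JensenPolynomials.FarGumbel

end
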